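import Summits.CriticalPhenomena.PercolationContinuityZ3.Theorems.PercNearOneGluingNoHeavyLowerTailSahiHereditaryMeetAbsorption
import HarnessLib

/-!
# `NoHeavyLowerTail` (stmt-CriticalPhenomena-4575) — structure of a MINIMAL COUNTEREXAMPLE to Sahi's conjecture at any order: no absorbing slot, hence an antichain

Support file, seat `prim-l12-p5` (gen 4), `--supports stmt-CriticalPhenomena-4575`.  No definitions, no named facts, no sorries.
Uses `…SahiDefectExpansion` (Theorem E `sahiE_cons_nonneg_of_absorbs_top`), `…SahiMomentExpansion` (sub-family bookkeeping) and
`…SahiHereditaryMeetAbsorption` (Theorem F).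

Call a family `g_0,…,g_{m−1}` a MINIMAL COUNTEREXAMPLE (for a weight `μ`) if `E_m(g) < 0` while its proper sub-families have `E ≥ 0`.  Theorem E says
that no slot of a minimal counterexample contains the meet of the others; since a slot lying ABOVE another slot contains that slot and hence every
meet through it, a minimal counterexample is an ANTICHAIN.  This is the all-order form of the lane's order-3 findings (comparable pair ⇒ `C_3` and
HC, `…SahiHalfCoSingletonComparable`; meet containment ⇒ `C_3`, `…SahiE3MeetContainment`): at every order the open part of Sahi's conjecture lives on
antichains in which no slot contains the meet of the others.

* `exists_defect_of_sahiE_cons_neg` — `E_{m+2}(d, g) < 0` with `g` hereditarily nonnegative forces `(1 − d)·∏ g ≠ 0` somewhere (`D ⊉ ⋂ A_i`).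
* `sahiE_nonneg_of_le_slot` — ANY probability weight `μ ≥ 0`, `{0,1}`-valued slots, `g_i ≤ g_j` (`i ≠ j`): if every nonempty sub-family AVOIDING `j`
  has `E ≥ 0` then `E_m(g) ≥ 0` (no hypothesis on sub-families through `j`, no monotonicity, no lattice).
* `not_le_of_sahiE_neg_minimal` — hence a minimal counterexample has pairwise incomparable slots.
* `sahiE_nonneg_of_le_slot_of_triplewise` (FKG lattices, monotone indicators) — a comparable pair `g_i ≤ g_j` over a remainder (the family without
  `j`) that is triplewise meet-contained gives `E_m(g) ≥ 0`, although triples THROUGH `j` may be hard-core: e.g. `E₄(x₀ ∨ x₃, x₀x₁, x₁, x₂ ∨ x₀x₁) ≥ 0`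
  under every FKG weight, with the hard-core sub-triple `(x₀ ∨ x₃, x₁, x₂ ∨ x₀x₁)`.
-/

namespace Summit.CriticalPhenomena.PercolationContinuityZ3.Theorems

namespace SahiHereditaryMeetAbsorption

open Finset Function Literature.Combinatorics.Sahi2008 SahiMomentExpansion SahiDefectExpansion
open scoped Nat

variable {α : Type*} [Fintype α]

/-! ### Structure of a minimal counterexample: no absorbing slot, hence an antichain -/

section Minimal

/-- **No slot of a minimal counterexample absorbs the meet of the others** (contrapositive of Theorem E): probability weight `μ ≥ 0`, `g_i ≥ 0`,
`d ≤ 1`; if every sub-family of `g` (including `g`) has `E ≥ 0` but `E_{m+2}(d, g) < 0`, then the top meet defect `(1 − d)·∏ g` does not vanish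
identically (for events: `D ⊉ ⋂_i A_i`). [this file] -/
theorem exists_defect_of_sahiE_cons_neg {μ : α → ℝ} (hμ0 : ∀ a, 0 ≤ μ a) (hμ1 : ∑ a, μ a = 1) (m : ℕ) (d : α → ℝ)
    (g : Fin (m + 1) → α → ℝ) (hg : ∀ i a, 0 ≤ g i a) (hd : ∀ a, d a ≤ 1)
    (hsub : ∀ T : Finset (Fin (m + 1)), T ≠ univ → 0 ≤ sahiE μ Tᶜ.card (fun j => g (Tᶜ.orderEmbOfFin rfl j)))
    (hneg : sahiE μ (m + 2) (Fin.cons d g : Fin (m + 2) → α → ℝ) < 0) :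
    ∃ a, (1 - d a) * ∏ i, g i a ≠ 0 := by
  by_contra h
  have h' : ∀ a, (1 - d a) * ∏ i, g i a = 0 := fun a => not_not.mp (not_exists.mp h a)
  exact absurd (sahiE_cons_nonneg_of_absorbs_top hμ0 hμ1 m d g hg hd h' hsub) (not_le.mpr hneg)

/-- **A comparable pair makes the larger slot absorbing**: probability weight `μ ≥ 0`, `{0,1}`-valued slots with `g_i ≤ g_j` (`i ≠ j`); if every
nonempty sub-family AVOIDING `j` has `E ≥ 0`, then `E_m(g) ≥ 0` — no hypothesis on the sub-families containing `j`, no monotonicity, no lattice.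
(`g_j ⊇ g_i ⊇ ∏_{l ≠ j} g_l`, Theorem E.) [this file] -/
theorem sahiE_nonneg_of_le_slot {μ : α → ℝ} (hμ0 : ∀ a, 0 ≤ μ a) (hμ1 : ∑ a, μ a = 1) {m : ℕ} (g : Fin m → α → ℝ)
    (h01 : ∀ i a, g i a = 0 ∨ g i a = 1) {i j : Fin m} (hij : i ≠ j) (hle : ∀ a, g i a ≤ g j a)
    (hsub : ∀ T : Finset (Fin m), j ∉ T → T.Nonempty → 0 ≤ sahiE μ T.card (fun l => g (T.orderEmbOfFin rfl l))) :
    0 ≤ sahiE μ m g := by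
  have hg0 : ∀ i x, 0 ≤ g i x := fun i x => by rcases h01 i x with e | e <;> simp [e]
  have hg1 : ∀ i x, g i x ≤ 1 := fun i x => by rcases h01 i x with e | e <;> simp [e]
  -- `m ≥ 2`
  obtain ⟨n, rfl⟩ : ∃ n, m = n + 2 := by
    have h2 : 2 ≤ m := by
      have := Fintype.card_le_of_injective (fun b : Bool => if b then i else j)
        (fun b₁ b₂ h => by cases b₁ <;> cases b₂ <;> simp_all)
      simpa using this
    exact ⟨m - 2, by omega⟩
  have hmove : sahiE μ (n + 2) g = sahiE μ (n + 2) (Fin.cons (g j) (j.removeNth g) : Fin (n + 2) → α → ℝ) := by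
    conv_lhs => rw [← update_eq_self j g]
    exact SahiMeetTowerAll.sahiE_update_eq_sahiE_cons μ (n + 1) g j (g j)
  rw [hmove]
  refine sahiE_cons_nonneg_of_absorbs_top hμ0 hμ1 n (g j) (j.removeNth g) (fun l x => hg0 _ x) (hg1 j) ?_ ?_
  · -- `g_j` absorbs the product of the others, which contains the factor `g_i ≤ g_j`
    intro x
    obtain ⟨i', hi'⟩ := Fin.exists_succAbove_eq hij
    rcases h01 j x with e | e
    · have hi0 : g i x = 0 := le_antisymm (e ▸ hle x) (hg0 i x)
      rw [Finset.prod_eq_zero (Finset.mem_univ i') (by simpa only [Fin.removeNth, hi'] using hi0), mul_zero]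
    · rw [e, sub_self, zero_mul]
  · -- sub-families of `j.removeNth g` are the sub-families of `g` avoiding `j`
    intro T hT
    have hne : Tᶜ.Nonempty := by
      rw [Finset.nonempty_iff_ne_empty, Ne, Finset.compl_eq_empty_iff]
      exact hT
    have key := hsub (Tᶜ.map (Fin.succAboveEmb j)) (not_mem_map_succAboveEmb j Tᶜ) (by simpa using hne)
    rwa [subfamily_map_succAbove] at key

/-- **A minimal counterexample is an antichain**: if `E_m(g) < 0` while every nonempty sub-family avoiding any single slot has `E ≥ 0`
(`{0,1}`-valued slots, probability weight `μ ≥ 0`), then no two distinct slots are comparable. [this file] -/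
theorem not_le_of_sahiE_neg_minimal {μ : α → ℝ} (hμ0 : ∀ a, 0 ≤ μ a) (hμ1 : ∑ a, μ a = 1) {m : ℕ} (g : Fin m → α → ℝ)
    (h01 : ∀ i a, g i a = 0 ∨ g i a = 1)
    (hsub : ∀ (j : Fin m) (T : Finset (Fin m)), j ∉ T → T.Nonempty → 0 ≤ sahiE μ T.card (fun l => g (T.orderEmbOfFin rfl l)))
    (hneg : sahiE μ m g < 0) {i j : Fin m} (hij : i ≠ j) : ¬ ∀ a, g i a ≤ g j a :=
  fun hle => absurd (sahiE_nonneg_of_le_slot hμ0 hμ1 g h01 hij hle (hsub j)) (not_le.mpr hneg)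

variable [DistribLattice α]

/-- **A comparable pair over a triplewise meet-contained remainder** (FKG): monotone indicators `g` with `g_i ≤ g_j`, `i ≠ j`, such that the family
WITHOUT the slot `j` is triplewise meet-contained; then `E_m(g) ≥ 0` — although triples through `j` may be hard-core (e.g.
`(x₀ ∨ x₃, x₀x₁, x₁, x₂ ∨ x₀x₁)`: `E₄ ≥ 0` with the hard-core sub-triple `(x₀ ∨ x₃, x₁, x₂ ∨ x₀x₁)`). [this file] -/
theorem sahiE_nonneg_of_le_slot_of_triplewise {μ : α → ℝ} (hμ : IsFKGMeasure μ) {m : ℕ} (g : Fin m → α → ℝ)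
    (h01 : ∀ i a, g i a = 0 ∨ g i a = 1) (hmono : ∀ i, Monotone (g i)) {i j : Fin m} (hij : i ≠ j) (hle : ∀ a, g i a ≤ g j a)
    (htri : ∀ S : Finset (Fin m), j ∉ S → S.card = 3 → ∃ p ∈ S, ∀ x, (1 - g p x) * ∏ l ∈ S.erase p, g l x = 0) :
    0 ≤ sahiE μ m g := by
  refine sahiE_nonneg_of_le_slot hμ.nonneg hμ.sum_eq_one g h01 hij hle fun T hjT _ => ?_
  refine sahiE_nonneg_of_triplewise_meetContainment hμ _ _ (fun l a => h01 _ a) (fun l => hmono _) fun S' hS' => ?_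
  let e : Fin T.card ↪o Fin m := T.orderEmbOfFin rfl
  have hjS : j ∉ S'.map e.toEmbedding := fun h => by
    obtain ⟨l, _, hl⟩ := Finset.mem_map.mp h
    exact hjT (hl ▸ Finset.orderEmbOfFin_mem T rfl l)
  obtain ⟨q, hq, hq'⟩ := htri (S'.map e.toEmbedding) hjS (by rwa [Finset.card_map])
  obtain ⟨q', hq'S, rfl⟩ := Finset.mem_map.mp hq
  refine ⟨q', hq'S, fun x => ?_⟩
  have key := hq' x
  rw [← Finset.map_erase, Finset.prod_map] at key
  simpa only [RelEmbedding.coe_toEmbedding] using key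

end Minimal

end SahiHereditaryMeetAbsorption

end Summit.CriticalPhenomena.PercolationContinuityZ3.Theorems
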